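import Literature.AlgebraicGeometry.Motives.ProjectiveOfGeneratingSections
import Literature.AlgebraicGeometry.Motives.CartierDivisorExtension
import Literature.AlgebraicGeometry.Motives.IntegralProjectiveSpace
import Literature.AlgebraicGeometry.Resolution.AffineBlowupIntegral
import Literature.AlgebraicGeometry.Motives.VarietiesProjectiveSpaceProofs
import HarnessLib

/-!
# The function field of projective space: the charts `(K[x]_{(x_l)})₀ ↪ K(ℙ^d)`

For projective space `ℙ^d_K = Proj K[x₀, …, x_d]` over a field `K` (the scheme
`(Literature.AlgebraicGeometry.Motives.projectiveSpace d K).left`) this file provides the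
elementary function-field calculus used to count sections of `𝒪(n)` in the concrete model of
`Motives/CartierDivisor` (`Motives/ProjectiveSpaceSections`):

* `ProjSpace.isIntegral` — `ℙ^d_K` is an integral scheme (`Proj` of a graded domain,
  `Literature.AlgebraicGeometry.Resolution.Proj.isIntegral`), proper over `K`, hence quasi-compact
  (separatedness is Mathlib's unconditional `Proj.instIsSeparated`);
* `ProjSpace.awayToFunctionField l : (K[x]_{(x_l)})₀ →+* K(ℙ^d)` (named apart from
  `RatFn.toFunctionField`, the map from a stalk) — the rational function of a
  degree-zero fraction `a / x_l^m`: the germ at the generic point of the corresponding section over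
  `D₊(x_l)` (the section being transported exactly as in `GeneratingSections.homRatio`, so that
  `awayToFunctionField l (x_j / x_l)` is the ratio `x_j/x_l` of the generating sections of `𝟙 ℙ^d`,
  `awayToFunctionField_frac`); it is injective (`awayToFunctionField_injective`), `K`-linear
  (`awayToFunctionField_cst`), and any two charts factor jointly through `(K[x]_{(x_l x_{l'})})₀`
  (`exists_awayToFunctionField_eq_comp_awayMap`, through an *injective* map), so that identities between
  rational functions coming from different charts reduce to identities between fractions (Görtz–Wedhorn I, Example 3.6 /
  (13.4): `K(ℙ^d) = Frac K[x₀/x_l, …, x_d/x_l]`);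
* `ProjSpace.exists_eq_awayToFunctionField` — every rational function regular on `D₊(x_l)` comes
  from `(K[x]_{(x_l)})₀` (`Γ(D₊(x_l), 𝒪) = (K[x]_{(x_l)})₀`, Mathlib `Proj.basicOpenIsoAway`, and
  `Γ(U, 𝒪) = ⋂_{x ∈ U} 𝒪_x`, Görtz–Wedhorn I, Prop. 3.29).

## References

* U. Görtz, T. Wedhorn, *Algebraic Geometry I: Schemes*, 2nd ed. (2020),
  doi:10.1007/978-3-658-30733-2: Example 3.6 and (3.7) (projective space by gluing, p. 74 ff.),
  Prop. 3.29 (p. 102), (13.2)–(13.4) (`Proj`, `D₊(f) = Spec A_{(f)}`), Example 13.16 (sections of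
  `𝒪(n)` on `ℙⁿ_R`). [GortzWedhorn2020]
-/

universe u

open CategoryTheory AlgebraicGeometry Limits HomogeneousLocalization TopologicalSpace Opposite
open MvPolynomial (X C)
open Literature.AlgebraicGeometry.Motives.Segre Literature.AlgebraicGeometry.Motives.RatFn

attribute [local instance] MvPolynomial.gradedAlgebra

noncomputable section

namespace Literature.AlgebraicGeometry.Motives

/-! ### A restriction lemma -/

/-- Transporting the pullback of a global section along `U.topIso` is restricting it. [folklore] -/
theorem Scheme.Opens.topIso_hom_appTop {Y : Scheme.{u}} (V : Y.Opens) (s : Γ(Y, ⊤)) :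
    V.topIso.hom (V.ι.appTop s) = Y.presheaf.map (homOfLE le_top).op s := by
  simp only [Scheme.Opens.topIso_hom, Scheme.Opens.ι_appTop]
  rw [← CommRingCat.comp_apply]
  erw [← Y.presheaf.map_comp]
  rfl

namespace ProjSpace

variable (d : ℕ) (K : Type u) [Field K]

/-- Projective `d`-space over `K` as a bare scheme, `Proj K[x₀, …, x_d]`; this is (by `rfl`) the
underlying scheme of `Literature.AlgebraicGeometry.Motives.projectiveSpace d K`. [folklore] -/
abbrev P : Scheme.{u} := Proj (grading (Fin (d + 1)) K)

/-- `P d K` is the underlying scheme of `projectiveSpace d K` (unfolding). [folklore] -/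
theorem projectiveSpace_left : (projectiveSpace d K).left = P d K := rfl

/-- `ℙ^d_K` as a `K`-scheme via `Segre.toSpec` (which is, by `rfl`, the structure morphism of
`projectiveSpace d K`, `projectiveSpace_hom_eq_toSpec`). Mathlib has no instance making a bare
`Proj` a scheme over its degree-zero part (`OverClass.fromOver` gives one on the spelling
`(projectiveSpace d K).left`, definitionally but not syntactically equal to this one): downstream
files must use the `P d K` spelling throughout — `projectiveSpace_left` / `over_eq_toSpec` are the
bridges — so that e.g. `Algebra K (P d K).functionField` (`RatFn.algebraStalk`) is found by `rw`/`simp`.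
[folklore] -/
instance instOver : (P d K).Over (Spec (.of K)) := ⟨toSpec (Fin (d + 1)) K⟩

/-- The structure morphism of `ℙ^d_K` is `Segre.toSpec` (unfolding). [folklore] -/
theorem over_eq_toSpec : (P d K) ↘ Spec (.of K) = toSpec (Fin (d + 1)) K := rfl

/-- The irrelevant ideal of `K[x₀, …, x_d]` is nonzero (it contains `x₀`). [folklore] -/
theorem irrelevant_ne_bot :
    HomogeneousIdeal.irrelevant (grading (Fin (d + 1)) K) ≠ ⊥ := by
  intro h
  have hx : (X 0 : MvPolynomial (Fin (d + 1)) K) ∈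
      (HomogeneousIdeal.irrelevant (grading (Fin (d + 1)) K)).toIdeal :=
    HomogeneousIdeal.mem_irrelevant_of_mem _ zero_lt_one (X_mem K 0)
  rw [h] at hx
  exact MvPolynomial.X_ne_zero 0 ((Submodule.mem_bot _).1 hx)

/-- **`ℙ^d_K` is an integral scheme** (`Proj` of the graded domain `K[x₀,…,x_d]`). [folklore] -/
instance isIntegral : IsIntegral (P d K) :=
  Resolution.Proj.isIntegral (grading (Fin (d + 1)) K) (irrelevant_ne_bot d K)

/-- `ℙ^d_K → Spec K` is proper (`Motives/IntegralProjectiveSpace`). [folklore] -/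
instance isProper_over : IsProper ((P d K) ↘ Spec (.of K)) :=
  ProjBaseChangeRing.isProper_projToSpec (Fin (d + 1)) K

/-- `ℙ^d_K` is quasi-compact. [folklore] -/
instance compactSpace : CompactSpace (P d K) :=
  QuasiCompact.compactSpace_of_compactSpace ((P d K) ↘ Spec (.of K))

variable {d K}

/-- The standard chart `D₊(x_l) ⊆ ℙ^d`, written as the open `(𝟙 ℙ^d)⁻¹ D₊(x_l)` of the generating
sections of `𝟙 ℙ^d` (`GeneratingSections.preU`) so as to reuse their calculus verbatim. [folklore] -/
abbrev U (l : Fin (d + 1)) : (P d K).Opens := GeneratingSections.preU (𝟙 (P d K)) l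

/-- Membership in the chart `U l` is membership in `D₊(x_l)` (unfolding). [folklore] -/
theorem mem_U_iff (l : Fin (d + 1)) (y : P d K) :
    y ∈ U l ↔ y ∈ Proj.basicOpen (grading (Fin (d + 1)) K) (X l) := Iff.rfl

/-- The chart `U l` is `D₊(x_l)` as a set (unfolding). [folklore] -/
theorem coe_U (l : Fin (d + 1)) :
    (U (d := d) (K := K) l : Set (P d K)) = Proj.basicOpen (grading (Fin (d + 1)) K) (X l) := rfl

/-- The point `(0) ∈ ℙ^d` (the zero ideal of the domain `K[x]`, a relevant homogeneous prime):
the point `ProjectiveSpace.genericPoint d K` of `Motives/VarietiesProjectiveSpaceProofs`, read in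
`P d K`. [folklore] -/
abbrev zeroPt : P d K := ProjectiveSpace.genericPoint d K

/-- `(0) ∈ D₊(x_l)` for every `l` (`ProjectiveSpace.genericPoint_mem_basicOpen`). [folklore] -/
theorem zeroPt_mem_U (l : Fin (d + 1)) : zeroPt ∈ U (d := d) (K := K) l :=
  (mem_U_iff l _).2 (ProjectiveSpace.genericPoint_mem_basicOpen d K l)

/-- The generic point of `ℙ^d` lies in every standard chart. [folklore] -/
theorem genericPoint_mem_U (l : Fin (d + 1)) : genericPoint (P d K) ∈ U l :=
  genericPoint_mem_of_mem (zeroPt_mem_U l)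

/-! ### The chart maps `(K[x]_{(x_l)})₀ → K(ℙ^d)` -/

/-- The section over `D₊(x_l)` of a degree-zero fraction `a ∈ (K[x]_{(x_l)})₀`, transported exactly
as the ratios `GeneratingSections.homRatio (𝟙 ℙ^d)` are. [folklore] -/
def sec (l : Fin (d + 1)) (a : Away (grading (Fin (d + 1)) K) (X l)) : Γ(P d K, U l) :=
  (U l).topIso.hom (pull (GeneratingSections.chartLift (𝟙 (P d K)) l) a)

/-- `sec l` is a ring homomorphism. [folklore] -/
def secRingHom (l : Fin (d + 1)) : Away (grading (Fin (d + 1)) K) (X l) →+* Γ(P d K, U l) :=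
  (U l).topIso.hom.hom.comp (pull (GeneratingSections.chartLift (𝟙 (P d K)) l))

/-- Unfolding `secRingHom`. [folklore] -/
@[simp] theorem secRingHom_apply (l : Fin (d + 1)) (a : Away (grading (Fin (d + 1)) K) (X l)) :
    secRingHom l a = sec l a := rfl

/-- The ratios of the generating sections of `𝟙 ℙ^d` are the sections of the fractions `x_j/x_l`.
[folklore] -/
theorem homRatio_id (l j : Fin (d + 1)) :
    GeneratingSections.homRatio (𝟙 (P d K)) l j = sec l (frac K l j) := rfl

/-- **The rational function of a degree-zero fraction**: `(K[x]_{(x_l)})₀ → K(ℙ^d)`, the germ at the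
generic point of its section over `D₊(x_l)`. [folklore] -/
def awayToFunctionField (l : Fin (d + 1)) : Away (grading (Fin (d + 1)) K) (X l) →+* (P d K).functionField :=
  ((P d K).presheaf.germ (U l) (genericPoint (P d K)) (genericPoint_mem_U l)).hom.comp (secRingHom l)

/-- Unfolding: `awayToFunctionField l a` is the rational function of the section `sec l a`. [folklore] -/
theorem awayToFunctionField_apply (l : Fin (d + 1)) (a : Away (grading (Fin (d + 1)) K) (X l)) :
    awayToFunctionField l a = ofSection (genericPoint_mem_U l) (sec l a) := rfl

/-- `awayToFunctionField l (x_j/x_l)` is the rational function `s_j/s_l` of the generating sections of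
`𝟙 ℙ^d` (`GeneratingSections.ratioFn`). [folklore] -/
theorem awayToFunctionField_frac (l j : Fin (d + 1)) :
    awayToFunctionField l (frac K l j) =
      (GeneratingSections.ofHom (𝟙 (P d K))).ratioFn l j (genericPoint_mem_U l) := rfl

/-- Rational functions in the image of a chart are regular on that chart. [folklore] -/
theorem isRegularAt_awayToFunctionField (l : Fin (d + 1)) (a : Away (grading (Fin (d + 1)) K) (X l))
    {y : P d K} (hy : y ∈ U l) : IsRegularAt y (awayToFunctionField l a) :=
  isRegularAt_ofSection hy _

/-- The chart morphism `D₊(x_l) → Spec (K[x]_{(x_l)})₀` used in the transport is an isomorphism.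
[folklore] -/
instance isIso_chartLift (l : Fin (d + 1)) :
    IsIso (GeneratingSections.chartLift (𝟙 (P d K)) l) := by
  have hrange : Set.range (U (d := d) (K := K) l).ι = Set.range (chartι K l) := by
    rw [Scheme.Opens.range_ι, ← Scheme.Hom.coe_opensRange, Proj.opensRange_awayι, coe_U]
  have e : GeneratingSections.chartLift (𝟙 (P d K)) l =
      (IsOpenImmersion.isoOfRangeEq (U l).ι (chartι K l) hrange).hom := by
    apply IsOpenImmersion.lift_uniq
    change (IsOpenImmersion.isoOfRangeEq (U l).ι (chartι K l) hrange).hom ≫ chartι K l = (U l).ι ≫ 𝟙 _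
    rw [Category.comp_id]
    exact IsOpenImmersion.lift_fac _ _ _
  rw [e]
  infer_instance

/-- `sec l` is bijective (`Γ(D₊(x_l), 𝒪) = (K[x]_{(x_l)})₀`). [folklore] -/
theorem sec_bijective (l : Fin (d + 1)) : Function.Bijective (sec (d := d) (K := K) l) := by
  change Function.Bijective ((U l).topIso.hom.hom ∘ pull (GeneratingSections.chartLift (𝟙 (P d K)) l))
  refine (U l).topIso.commRingCatIsoToRingEquiv.bijective.comp ?_
  change Function.Bijective ((Scheme.ΓSpecIso _).inv ≫
    (GeneratingSections.chartLift (𝟙 (P d K)) l).appTop).hom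
  haveI := isIso_chartLift (d := d) (K := K) l
  haveI : IsIso (GeneratingSections.chartLift (𝟙 (P d K)) l).op := inferInstance
  haveI : IsIso (GeneratingSections.chartLift (𝟙 (P d K)) l).appTop := by
    rw [← Scheme.Γ_map_op]; exact Functor.map_isIso _ _
  exact (asIso ((Scheme.ΓSpecIso _).inv ≫
    (GeneratingSections.chartLift (𝟙 (P d K)) l).appTop)).commRingCatIsoToRingEquiv.bijective

/-- **`(K[x]_{(x_l)})₀ → K(ℙ^d)` is injective.** [folklore] -/
theorem awayToFunctionField_injective (l : Fin (d + 1)) :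
    Function.Injective (awayToFunctionField (d := d) (K := K) l) :=
  (germ_injective_of_isIntegral _ (genericPoint (P d K)) (genericPoint_mem_U l)).comp
    (sec_bijective l).1

/-- **Every rational function regular on `D₊(x_l)` is a degree-zero fraction**: the image of
`awayToFunctionField l` is the subring of functions regular at all points of `D₊(x_l)`
(`Γ(U, 𝒪) = ⋂_{x ∈ U} 𝒪_x` and `Γ(D₊(x_l), 𝒪) = (K[x]_{(x_l)})₀`). [folklore] -/
theorem exists_eq_awayToFunctionField (l : Fin (d + 1)) {h : (P d K).functionField}
    (hh : ∀ y ∈ U l, IsRegularAt y h) : ∃ a, awayToFunctionField l a = h := by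
  obtain ⟨σ, hσ⟩ := exists_germ_eq_of_forall_isRegularAt (genericPoint_mem_U l) hh
  obtain ⟨a, rfl⟩ := (sec_bijective l).2 σ
  exact ⟨a, hσ⟩

/-! ### Two charts factor through `(K[x]_{(x_l x_{l'})})₀` -/

/-- Restricting a transported section `sec l a` to `W ⊆ D₊(x_l)` is transporting the pullback along
`W → D₊(x_l) → Spec (K[x]_{(x_l)})₀`. [folklore] -/
theorem map_sec {W : (P d K).Opens} (l : Fin (d + 1)) (hW : W ≤ U l)
    (a : Away (grading (Fin (d + 1)) K) (X l)) :
    (P d K).presheaf.map (homOfLE hW).op (sec l a) =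
      W.topIso.hom (pull ((P d K).homOfLE hW ≫ GeneratingSections.chartLift (𝟙 (P d K)) l) a) := by
  rw [pull_comp]
  exact GeneratingSections.rs_topIso_hom hW _

/-- **Joint chart.** For two standard charts `l, l'` there is a ring homomorphism
`ρ : (K[x]_{(x_l x_{l'})})₀ → K(ℙ^d)` through which both `awayToFunctionField l` and `awayToFunctionField l'`
factor via the transition maps `(K[x]_{(x_l)})₀ → (K[x]_{(x_l x_{l'})})₀ ← (K[x]_{(x_{l'})})₀` (the
two chart morphisms on `D₊(x_l) ∩ D₊(x_{l'})` both factor through `D₊(x_l x_{l'})`,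
`Segre.exists_lift_of_comp_chartι_eq`). Hence identities in `K(ℙ^d)` between functions from
different charts reduce to identities between fractions. [folklore] -/
theorem exists_awayToFunctionField_eq_comp_awayMap (l l' : Fin (d + 1)) :
    ∃ ρ : Away (grading (Fin (d + 1)) K) (X l * X l') →+* (P d K).functionField,
      Function.Injective ρ ∧
      awayToFunctionField l = ρ.comp (awayMap (grading (Fin (d + 1)) K) (X_mem K l')
        (rfl : X l * X l' = X l * X l')) ∧
      awayToFunctionField l' = ρ.comp (awayMap (grading (Fin (d + 1)) K) (X_mem K l)
        (mul_comm (X l) (X l'))) := by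
  set W : (P d K).Opens := U l ⊓ U l' with hW
  set αl := (P d K).homOfLE (inf_le_left : W ≤ U l) ≫ GeneratingSections.chartLift (𝟙 (P d K)) l
    with hαl
  set αl' := (P d K).homOfLE (inf_le_right : W ≤ U l') ≫ GeneratingSections.chartLift (𝟙 (P d K)) l'
    with hαl'
  have hα : αl ≫ chartι K l = αl' ≫ chartι K l' := by
    rw [hαl, hαl', Category.assoc, Category.assoc, GeneratingSections.chartLift_chartι,
      GeneratingSections.chartLift_chartι, Scheme.homOfLE_ι_assoc, Scheme.homOfLE_ι_assoc]
  obtain ⟨γ, hγl, hγl'⟩ := exists_lift_of_comp_chartι_eq αl αl' hα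
  have hξW : genericPoint (P d K) ∈ W := ⟨genericPoint_mem_U l, genericPoint_mem_U l'⟩
  set ρ : Away (grading (Fin (d + 1)) K) (X l * X l') →+* (P d K).functionField :=
    ((P d K).presheaf.germ W (genericPoint (P d K)) hξW).hom.comp (W.topIso.hom.hom.comp (pull γ))
    with hρ
  have h1 : awayToFunctionField l = ρ.comp (awayMap (grading (Fin (d + 1)) K) (X_mem K l')
      (rfl : X l * X l' = X l * X l')) := by
    ext a
    change ofSection (genericPoint_mem_U l) (sec l a) =
      ofSection hξW (W.topIso.hom (pull γ (awayMap _ _ _ a)))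
    calc ofSection (genericPoint_mem_U l) (sec l a)
        = ofSection hξW ((P d K).presheaf.map (homOfLE (inf_le_left : W ≤ U l)).op (sec l a)) :=
          (ofSection_map _ _ _).symm
      _ = ofSection hξW (W.topIso.hom (pull αl a)) := by rw [map_sec]
      _ = ofSection hξW (W.topIso.hom (pull γ (awayMap _ _ _ a))) := by
          rw [← hγl, pull_SpecMap']; rfl
  -- injectivity: `(K[x]_{(x_l x_{l'})})₀ = (K[x]_{(x_l)})₀[(x_{l'}/x_l)⁻¹]`, `ρ` extends the injective
  -- `awayToFunctionField l`, and the target is a field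
  have hinj : Function.Injective ρ := by
    letI := (awayMap (grading (Fin (d + 1)) K) (X_mem K l') (rfl : X l * X l' = X l * X l')).toAlgebra
    haveI := Away.isLocalization_mul (X_mem K l) (X_mem K l') (rfl : X l * X l' = X l * X l')
      one_ne_zero
    refine (injective_iff_map_eq_zero ρ).2 fun z hz => ?_
    obtain ⟨⟨a, s⟩, e⟩ := IsLocalization.surj (Submonoid.powers (frac K l l')) z
    have ha : awayToFunctionField l a = 0 := by
      have e' := congrArg ρ e
      rw [map_mul, hz, zero_mul] at e'
      rw [h1, RingHom.comp_apply]
      exact e'.symm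
    have ha0 : a = 0 := awayToFunctionField_injective l (by rw [ha, map_zero])
    rw [ha0, map_zero] at e
    exact (IsLocalization.map_units (Away (grading (Fin (d + 1)) K) (X l * X l')) s).mul_left_eq_zero.1 e
  refine ⟨ρ, hinj, h1, ?_⟩
  · ext a
    change ofSection (genericPoint_mem_U l') (sec l' a) =
      ofSection hξW (W.topIso.hom (pull γ (awayMap _ _ _ a)))
    calc ofSection (genericPoint_mem_U l') (sec l' a)
        = ofSection hξW ((P d K).presheaf.map (homOfLE (inf_le_right : W ≤ U l')).op (sec l' a)) :=
          (ofSection_map _ _ _).symm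
      _ = ofSection hξW (W.topIso.hom (pull αl' a)) := by rw [map_sec]
      _ = ofSection hξW (W.topIso.hom (pull γ (awayMap _ _ _ a))) := by
          rw [← hγl', pull_SpecMap']; rfl

/-! ### Constants -/

/-- **The chart maps are `K`-linear**: `awayToFunctionField l (c / 1) = c` in `K(ℙ^d)` (the `K`-algebra
structure on `K(ℙ^d)` being `K = Γ(Spec K) → Γ(ℙ^d, 𝒪) → K(ℙ^d)`, `RatFn.algebraStalk`). [folklore] -/
theorem awayToFunctionField_cst (l : Fin (d + 1)) (c : K) :
    awayToFunctionField l (cst K (X l) c) = algebraMap K (P d K).functionField c := by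
  rw [awayToFunctionField_apply, algebraMap_stalk_apply]
  change ofSection _ ((U l).topIso.hom (pull (GeneratingSections.chartLift (𝟙 (P d K)) l)
    (cst K (X l) c))) = _
  have h1 : pull (GeneratingSections.chartLift (𝟙 (P d K)) l) (cst K (X l) c) =
      pull ((U l).ι ≫ toSpec (Fin (d + 1)) K) c := by
    have e : (U l).ι ≫ toSpec (Fin (d + 1)) K = GeneratingSections.chartLift (𝟙 (P d K)) l ≫
        Spec.map (CommRingCat.ofHom (cst K (X l))) := by
      rw [← chartι_toSpec, ← Category.assoc, GeneratingSections.chartLift_chartι, Category.assoc,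
        Category.id_comp]
    rw [e, pull_SpecMap']
    rfl
  rw [h1, pull_comp, RingHom.comp_apply, pull_apply, Scheme.Opens.topIso_hom_appTop]
  change ofSection _ ((P d K).presheaf.map (homOfLE le_top).op _) = _
  rw [ofSection_map]
  rfl

end ProjSpace

end Literature.AlgebraicGeometry.Motives

end
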